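import Literature.NumberTheory.Sieve.GreenTao2008CoprimeLogSum
import HarnessLib

/-!
# Selberg's diagonalisation of `∑ μ(d)μ(d') log(X₁/d) log(X₂/d') / [d,d']` with a coprimality condition

Everything in this file is PROVED. Third brick of the elementary proof of
Green–Tao's Proposition 9.5 (`Literature.NumberTheory.Sieve.GreenTao2008.GoldstonYildirimLinearForms`). For a modulus `q ≥ 1`
and levels `X₁, X₂` put `a_q(X; d) = 1_{(d,q)=1} μ(d) log(X/d)` (`selbergCoeff`) and

  `B_q(X₁, X₂) = ∑_{d ≤ X₁} ∑_{d' ≤ X₂} a_q(X₁; d) a_q(X₂; d') / lcm(d, d')`     (`selbergB`),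
  `S_q(X) = B_q(X, X)`                                                              (`selbergS`).

For `q = W = ∏_{p ≤ w} p` and `X₁ = X₂ = R`, `S_W(R) = E(Λ_R(Wx+1)² | x)` up to the box error —
the `m = 1` case of Green–Tao's Proposition 9.5 — and the general case is compared with
`S_W(R)^m` in `GreenTao2008CorrelationComparison`. Here (Selberg 1947; Graham 1978):

* `selbergB_eq_sum`: **diagonalisation** `B_q(X₁,X₂) = ∑_r φ(r) β_r(X₁) β_r(X₂)` with
  `β_r(X) = ∑_{r ∣ d} a_q(X; d)/d` (`1/lcm(d,d') = ∑_{r ∣ d, r ∣ d'} φ(r)/(dd')`);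
* `selbergBeta_eq`: `β_r(X) = 1_{(r,q)=1} (μ(r)/r) M₁(X/r; rq)` (the twisted Riesz means of
  `GreenTao2008CoprimeLogSum`), hence `selbergS_eq`:
  `S_q(X) = ∑_{r ≤ X, (r,q)=1} φ(r) μ(r)²/r² · M₁(X/r; rq)²` and `S_q(X) ≥ 0`;
* `selbergB_sq_le`: Cauchy–Schwarz `B_q(X₁,X₂)² ≤ S_q(X₁) S_q(X₂)`;
* `selbergS_le_of_bound`: the crude bound `S_q(X) ≤ C₀² (q/φ(q))² ∑_{r ≤ X} μ²(r)/φ(r)` and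
  `sum_sq_moebius_div_totient_le`: `∑_{r ≤ X} μ²(r)/φ(r) ≤ ∏_{p ≤ X} (1 - 1/p)⁻¹ ≤ e⁵ log X`.

## References

* B. Green, T. Tao, Ann. of Math. 167 (2008), §10 (the estimate served). [cite: GreenTaoAnnals2008]
* A. Selberg, *On an elementary method in the theory of primes*, Norske Vid. Selsk. Forh. 19 (1947)
  (the diagonalisation `∑ λ_d λ_e/[d,e] = ∑ φ(r) y_r²`). [folklore]
* S. W. Graham, *An asymptotic estimate related to Selberg's sieve*, J. Number Theory 10 (1978),
  83–94. [folklore]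
-/

noncomputable section

open Real Finset Filter ArithmeticFunction
open scoped ArithmeticFunction.Moebius

namespace Literature.NumberTheory.Sieve.GreenTao2008

/-! ### The forms -/

/-- `a_q(X; d) = 1_{(d,q)=1} μ(d) log(X/d)`. [cite: GreenTaoAnnals2008, Definition 9.2] -/
def selbergCoeff (q : ℕ) (X : ℝ) (d : ℕ) : ℝ :=
  if d.Coprime q then (μ d : ℝ) * Real.log (X / d) else 0

/-- `B_q(X₁, X₂) = ∑_{d ≤ X₁} ∑_{d' ≤ X₂} a_q(X₁; d) a_q(X₂; d') / lcm(d, d')`. [folklore] -/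
def selbergB (q : ℕ) (X₁ X₂ : ℝ) : ℝ :=
  ∑ d ∈ Finset.Icc 1 ⌊X₁⌋₊, ∑ e ∈ Finset.Icc 1 ⌊X₂⌋₊,
    selbergCoeff q X₁ d * selbergCoeff q X₂ e / (Nat.lcm d e : ℝ)

/-- `S_q(X) = B_q(X, X) = ∑_{d,d' ≤ X, (dd',q)=1} μ(d)μ(d') log(X/d) log(X/d') / lcm(d,d')`.
[folklore] -/
def selbergS (q : ℕ) (X : ℝ) : ℝ := selbergB q X X

/-- `β_r(X) = ∑_{d ≤ X, r ∣ d} a_q(X; d)/d` (Selberg's diagonal variables). [folklore] -/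
def selbergBeta (q : ℕ) (X : ℝ) (r : ℕ) : ℝ :=
  ∑ d ∈ (Finset.Icc 1 ⌊X⌋₊).filter (r ∣ ·), selbergCoeff q X d / d

/-- Unfolding `selbergS`. [folklore] -/
theorem selbergS_def (q : ℕ) (X : ℝ) : selbergS q X = selbergB q X X := rfl

/-- `|a_q(X; d)| ≤ log(X/d)` in absolute value `≤ |log(X/d)|`. [folklore] -/
theorem abs_selbergCoeff_le (q : ℕ) (X : ℝ) (d : ℕ) : |selbergCoeff q X d| ≤ |Real.log (X / d)| := by
  unfold selbergCoeff
  split_ifs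
  · rw [abs_mul]
    calc |(μ d : ℝ)| * |Real.log (X / d)| ≤ 1 * |Real.log (X / d)| :=
          mul_le_mul_of_nonneg_right (by exact_mod_cast ArithmeticFunction.abs_moebius_le_one) (abs_nonneg _)
      _ = |Real.log (X / d)| := one_mul _
  · rw [abs_zero]; exact abs_nonneg _

/-! ### Diagonalisation -/

/-- `1/lcm(d,e) = ∑_{r ∣ d, r ∣ e} φ(r)/(de)` (`gcd = ∑_{r ∣ gcd} φ(r)`), the divisors `r` taken in
`[1, N]` for any `N ≥ d`. [folklore] -/
theorem inv_lcm_eq_sum_totient {d e N : ℕ} (hd : d ≠ 0) (he : e ≠ 0) (hN : d ≤ N) :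
    (1 : ℝ) / (Nat.lcm d e : ℝ) =
      ∑ r ∈ (Finset.Icc 1 N).filter (fun r => r ∣ d ∧ r ∣ e), (r.totient : ℝ) / ((d : ℝ) * e) := by
  have hset : (Finset.Icc 1 N).filter (fun r => r ∣ d ∧ r ∣ e) = (Nat.gcd d e).divisors := by
    ext r
    simp only [mem_filter, Finset.mem_Icc, Nat.mem_divisors, Nat.dvd_gcd_iff, ne_eq,
      Nat.gcd_eq_zero_iff, hd, he, and_self, not_false_eq_true, and_true]
    constructor
    · rintro ⟨-, h⟩; exact h
    · rintro ⟨h1, h2⟩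
      have hr0 : r ≠ 0 := by rintro rfl; exact hd (Nat.eq_zero_of_zero_dvd h1)
      exact ⟨⟨Nat.one_le_iff_ne_zero.2 hr0, (Nat.le_of_dvd (Nat.pos_of_ne_zero hd) h1).trans hN⟩, h1, h2⟩
  rw [hset, ← sum_div]
  have hsum : ∑ r ∈ (Nat.gcd d e).divisors, (r.totient : ℝ) = (Nat.gcd d e : ℝ) := by
    exact_mod_cast Nat.sum_totient (Nat.gcd d e)
  rw [hsum]
  have hlcm : (Nat.lcm d e : ℝ) ≠ 0 := by exact_mod_cast Nat.lcm_ne_zero hd he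
  have hde : ((d : ℝ) * e) ≠ 0 := by exact_mod_cast Nat.mul_ne_zero hd he
  rw [div_eq_div_iff hlcm hde, one_mul]
  exact_mod_cast (Nat.gcd_mul_lcm d e).symm

/-- **Selberg's diagonalisation**: `B_q(X₁, X₂) = ∑_{r ≤ N} φ(r) β_r(X₁) β_r(X₂)` for any
`N ≥ ⌊X₁⌋`. [folklore] -/
theorem selbergB_eq_sum (q : ℕ) (X₁ X₂ : ℝ) {N : ℕ} (hN : ⌊X₁⌋₊ ≤ N) :
    selbergB q X₁ X₂ = ∑ r ∈ Finset.Icc 1 N, (r.totient : ℝ) * (selbergBeta q X₁ r * selbergBeta q X₂ r) := by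
  classical
  unfold selbergB selbergBeta
  -- expand `1/lcm`
  have hterm : ∀ d ∈ Finset.Icc 1 ⌊X₁⌋₊, ∀ e ∈ Finset.Icc 1 ⌊X₂⌋₊,
      selbergCoeff q X₁ d * selbergCoeff q X₂ e / (Nat.lcm d e : ℝ) =
        ∑ r ∈ Finset.Icc 1 N, if r ∣ d ∧ r ∣ e then
          (r.totient : ℝ) * ((selbergCoeff q X₁ d / d) * (selbergCoeff q X₂ e / e)) else 0 := by
    intro d hd e he
    have hd0 : d ≠ 0 := by have := (Finset.mem_Icc.1 hd).1; omega
    have he0 : e ≠ 0 := by have := (Finset.mem_Icc.1 he).1; omega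
    have hd0' : (d : ℝ) ≠ 0 := by exact_mod_cast hd0
    have he0' : (e : ℝ) ≠ 0 := by exact_mod_cast he0
    rw [← sum_filter, div_eq_mul_one_div, inv_lcm_eq_sum_totient hd0 he0 ((Finset.mem_Icc.1 hd).2.trans hN),
      mul_sum]
    refine sum_congr rfl fun r _ => ?_
    field_simp
  rw [sum_congr rfl fun d hd => sum_congr rfl fun e he => hterm d hd e he]
  -- bring the sum over `r` outside
  rw [sum_congr rfl fun d _ => Finset.sum_comm, Finset.sum_comm]
  refine sum_congr rfl fun r _ => ?_
  -- factor the double sum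
  have hsplit : ∀ d e : ℕ, (if r ∣ d ∧ r ∣ e then
      (r.totient : ℝ) * ((selbergCoeff q X₁ d / d) * (selbergCoeff q X₂ e / e)) else 0) =
      (r.totient : ℝ) * ((if r ∣ d then selbergCoeff q X₁ d / d else 0) *
        (if r ∣ e then selbergCoeff q X₂ e / e else 0)) := by
    intro d e
    by_cases h1 : r ∣ d <;> by_cases h2 : r ∣ e <;> simp [h1, h2]
  simp_rw [hsplit]
  simp_rw [← mul_sum]
  congr 1
  rw [sum_filter, sum_filter, sum_mul_sum]
  exact sum_congr rfl fun _ _ => by rw [mul_sum]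

/-! ### Evaluation of `β_r` -/

/-- The multiples of `r ≥ 1` in `[1, M]` are `r · [1, M/r]`. [folklore] -/
theorem filter_dvd_Icc_eq_map {M r : ℕ} (hr : r ≠ 0) :
    (Finset.Icc 1 M).filter (r ∣ ·) = (Finset.Icc 1 (M / r)).map ⟨(r * ·), mul_right_injective₀ hr⟩ := by
  ext x
  simp only [mem_filter, Finset.mem_Icc, Finset.mem_map, Function.Embedding.coeFn_mk]
  constructor
  · rintro ⟨⟨h1, h2⟩, ⟨e, rfl⟩⟩
    have he : e ≠ 0 := by rintro rfl; simp at h1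
    refine ⟨e, ⟨Nat.one_le_iff_ne_zero.2 he, ?_⟩, rfl⟩
    exact (Nat.le_div_iff_mul_le (Nat.pos_of_ne_zero hr)).2 (by rw [mul_comm]; exact h2)
  · rintro ⟨e, ⟨h1, h2⟩, rfl⟩
    have h3 := (Nat.le_div_iff_mul_le (Nat.pos_of_ne_zero hr)).1 h2
    refine ⟨⟨Nat.one_le_iff_ne_zero.2 (Nat.mul_ne_zero hr (by omega)), by rw [mul_comm]; exact h3⟩,
      dvd_mul_right r e⟩

/-- `μ(re) = μ(r)μ(e)` for coprime `r, e`, and `μ(re) = 0` otherwise. [folklore] -/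
theorem moebius_mul_eq (r e : ℕ) :
    (μ (r * e) : ℝ) = if r.Coprime e then (μ r : ℝ) * μ e else 0 := by
  split_ifs with h
  · exact_mod_cast ArithmeticFunction.isMultiplicative_moebius.map_mul_of_coprime h
  · have : ¬Squarefree (r * e) := fun hs => h (Nat.squarefree_mul_iff.1 hs).1
    exact_mod_cast ArithmeticFunction.moebius_eq_zero_of_not_squarefree this

/-- **`β_r(X) = 1_{(r,q)=1} (μ(r)/r) M₁(X/r; rq)`** (substitute `d = re`: `μ(re) = μ(r)μ(e)` for
`(e, r) = 1` and `0` otherwise, `log(X/(re)) = log((X/r)/e)`). [folklore] -/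
theorem selbergBeta_eq (q : ℕ) (X : ℝ) {r : ℕ} (hr : r ≠ 0) :
    selbergBeta q X r = if r.Coprime q then (μ r : ℝ) / r * coprimeLogSum (r * q) (X / r) else 0 := by
  classical
  unfold selbergBeta
  rw [filter_dvd_Icc_eq_map hr, sum_map, ← Nat.floor_div_natCast]
  simp only [Function.Embedding.coeFn_mk]
  have hr0 : (r : ℝ) ≠ 0 := by exact_mod_cast hr
  by_cases hrq : r.Coprime q
  · rw [if_pos hrq, coprimeLogSum, sum_filter, mul_sum]
    refine sum_congr rfl fun e he => ?_
    have he0 : e ≠ 0 := by have := (Finset.mem_Icc.1 he).1; omega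
    have he0' : (e : ℝ) ≠ 0 := by exact_mod_cast he0
    unfold selbergCoeff
    rw [moebius_mul_eq]
    by_cases her : r.Coprime e
    · by_cases heq : e.Coprime q
      · have h1 : (r * e).Coprime q := Nat.Coprime.mul_left hrq heq
        have h2 : e.Coprime (r * q) := Nat.Coprime.mul_right her.symm heq
        rw [if_pos h1, if_pos her, if_pos h2]
        push_cast
        rw [← div_div]
        field_simp
      · have h1 : ¬(r * e).Coprime q := fun h => heq (Nat.Coprime.coprime_dvd_left (dvd_mul_left e r) h)
        have h2 : ¬e.Coprime (r * q) := fun h => heq (Nat.Coprime.coprime_dvd_right (dvd_mul_left q r) h)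
        rw [if_neg h1, if_neg h2]; simp
    · have h2 : ¬e.Coprime (r * q) := fun h => her (Nat.Coprime.coprime_dvd_right (dvd_mul_right r q) h).symm
      rw [if_neg her, if_neg h2]
      simp
  · rw [if_neg hrq]
    refine sum_eq_zero fun e _ => ?_
    unfold selbergCoeff
    have h1 : ¬(r * e).Coprime q := fun h => hrq (Nat.Coprime.coprime_dvd_left (dvd_mul_right r e) h)
    rw [if_neg h1]; simp

/-- **`S_q(X) = ∑_{r ≤ X, (r,q)=1} φ(r) μ(r)²/r² · M₁(X/r; rq)²`** (`S_q(X) ≥ 0` in particular).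
[folklore] -/
theorem selbergS_eq (q : ℕ) (X : ℝ) :
    selbergS q X = ∑ r ∈ (Finset.Icc 1 ⌊X⌋₊).filter (fun r => r.Coprime q),
      (r.totient : ℝ) * (μ r : ℝ) ^ 2 / (r : ℝ) ^ 2 * coprimeLogSum (r * q) (X / r) ^ 2 := by
  rw [selbergS, selbergB_eq_sum q X X le_rfl, sum_filter]
  refine sum_congr rfl fun r hr => ?_
  have hr0 : r ≠ 0 := by have := (Finset.mem_Icc.1 hr).1; omega
  have hr0' : (r : ℝ) ≠ 0 := by exact_mod_cast hr0
  rw [selbergBeta_eq q X hr0]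
  split_ifs
  · field_simp
  · simp

/-- `S_q(X) ≥ 0` (a sum of squares after diagonalisation). [folklore] -/
theorem selbergS_nonneg (q : ℕ) (X : ℝ) : 0 ≤ selbergS q X := by
  rw [selbergS, selbergB_eq_sum q X X le_rfl]
  exact sum_nonneg fun r _ => mul_nonneg (Nat.cast_nonneg _) (mul_self_nonneg _)

/-- **Cauchy–Schwarz**: `B_q(X₁, X₂)² ≤ S_q(X₁) S_q(X₂)`. [folklore] -/
theorem selbergB_sq_le (q : ℕ) (X₁ X₂ : ℝ) : selbergB q X₁ X₂ ^ 2 ≤ selbergS q X₁ * selbergS q X₂ := by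
  set N := max ⌊X₁⌋₊ ⌊X₂⌋₊ with hN
  rw [selbergB_eq_sum q X₁ X₂ (le_max_left _ _), selbergS, selbergB_eq_sum q X₁ X₁ (le_max_left _ _),
    selbergS, selbergB_eq_sum q X₂ X₂ (le_max_right ⌊X₁⌋₊ _)]
  set u : ℕ → ℝ := fun r => Real.sqrt (r.totient : ℝ) * selbergBeta q X₁ r with hu
  set v : ℕ → ℝ := fun r => Real.sqrt (r.totient : ℝ) * selbergBeta q X₂ r with hv
  have hφ : ∀ r : ℕ, Real.sqrt (r.totient : ℝ) * Real.sqrt (r.totient : ℝ) = (r.totient : ℝ) :=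
    fun r => Real.mul_self_sqrt (Nat.cast_nonneg _)
  have h1 : ∑ r ∈ Finset.Icc 1 N, (r.totient : ℝ) * (selbergBeta q X₁ r * selbergBeta q X₂ r) =
      ∑ r ∈ Finset.Icc 1 N, u r * v r := sum_congr rfl fun r _ => by rw [hu, hv, ← hφ r]; ring
  have h2 : ∑ r ∈ Finset.Icc 1 N, (r.totient : ℝ) * (selbergBeta q X₁ r * selbergBeta q X₁ r) =
      ∑ r ∈ Finset.Icc 1 N, u r ^ 2 := sum_congr rfl fun r _ => by rw [hu, ← hφ r]; ring
  have h3 : ∑ r ∈ Finset.Icc 1 N, (r.totient : ℝ) * (selbergBeta q X₂ r * selbergBeta q X₂ r) =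
      ∑ r ∈ Finset.Icc 1 N, v r ^ 2 := sum_congr rfl fun r _ => by rw [hv, ← hφ r]; ring
  rw [h1, h2, h3]
  exact sum_mul_sq_le_sq_mul_sq _ _ _

/-- `|B_q(X₁,X₂)| ≤ max(S_q(X₁), S_q(X₂))` (from Cauchy–Schwarz, `√(ab) ≤ max(a,b)`). [folklore] -/
theorem abs_selbergB_le_max (q : ℕ) (X₁ X₂ : ℝ) :
    |selbergB q X₁ X₂| ≤ max (selbergS q X₁) (selbergS q X₂) := by
  have h := selbergB_sq_le q X₁ X₂
  have h1 := selbergS_nonneg q X₁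
  have h2 := selbergS_nonneg q X₂
  set m := max (selbergS q X₁) (selbergS q X₂) with hm
  have hm0 : 0 ≤ m := le_max_of_le_left h1
  have hprod : selbergS q X₁ * selbergS q X₂ ≤ m * m :=
    mul_le_mul (le_max_left _ _) (le_max_right _ _) h2 hm0
  have hB2 : selbergB q X₁ X₂ ^ 2 ≤ m ^ 2 := by rw [sq m]; exact h.trans hprod
  exact abs_le_of_sq_le_sq hB2 hm0

/-! ### The crude bound -/

/-- `(rq).primeFactors = r.primeFactors ∪ q.primeFactors`, so `E_1(rq) ≤ E_1(r) E_1(q)`. [folklore] -/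
theorem eulerFactorProd_primeFactors_mul_le {σ : ℝ} (hσ : 0 < σ) {r q : ℕ} (hr : r ≠ 0) (hq : q ≠ 0) :
    eulerFactorProd σ (r * q).primeFactors ≤ eulerFactorProd σ r.primeFactors * eulerFactorProd σ q.primeFactors := by
  rw [Nat.primeFactors_mul hr hq]
  exact eulerFactorProd_union_le hσ (primeFactors_prime r) (primeFactors_prime q)

/-- **The crude bound** `S_q(X) ≤ C₀² (q/φ(q))² ∑_{r ≤ X} μ²(r)/φ(r)`, given `|M₁(u)| ≤ C₀`
(so `|M₁(X/r; rq)| ≤ C₀ E_1(rq) ≤ C₀ (r/φ(r)) (q/φ(q))`). [folklore] -/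
theorem selbergS_le_of_bound {C₀ : ℝ} (hC₀ : ∀ u, |moebiusLogSum u| ≤ C₀) {q : ℕ} (hq : q ≠ 0) (X : ℝ) :
    selbergS q X ≤ C₀ ^ 2 * eulerFactorProd 1 q.primeFactors ^ 2 *
      ∑ r ∈ (Finset.Icc 1 ⌊X⌋₊).filter Squarefree, 1 / (r.totient : ℝ) := by
  classical
  have hC0 : 0 ≤ C₀ := (abs_nonneg _).trans (hC₀ 0)
  set E := eulerFactorProd 1 q.primeFactors with hE
  have hE0 : 0 ≤ E := (eulerFactorProd_pos one_pos (primeFactors_prime q)).le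
  rw [selbergS_eq, mul_sum, sum_filter, sum_filter]
  refine sum_le_sum fun r hr => ?_
  have hr0 : r ≠ 0 := by have := (Finset.mem_Icc.1 hr).1; omega
  have hr0' : (0 : ℝ) < r := by exact_mod_cast Nat.pos_of_ne_zero hr0
  have hφ0 : (0 : ℝ) < (r.totient : ℝ) := by exact_mod_cast Nat.totient_pos.2 (Nat.pos_of_ne_zero hr0)
  by_cases hsq : Squarefree r
  · rw [if_pos hsq]
    split_ifs with hcop
    · -- `|M₁(X/r; rq)| ≤ C₀ E_1(rq) ≤ C₀ (r/φ r) E`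
      have hb : |coprimeLogSum (r * q) (X / r)| ≤ C₀ * ((r : ℝ) / (r.totient : ℝ) * E) := by
        refine (abs_coprimeLogSum_le hC₀ (Nat.mul_ne_zero hr0 hq) _).trans ?_
        refine mul_le_mul_of_nonneg_left ?_ hC0
        rw [← eulerFactorProd_one_primeFactors hr0, hE]
        exact eulerFactorProd_primeFactors_mul_le one_pos hr0 hq
      have hμ : (μ r : ℝ) ^ 2 ≤ 1 := by
        have : |(μ r : ℝ)| ≤ 1 := by exact_mod_cast ArithmeticFunction.abs_moebius_le_one
        rw [← sq_abs]; nlinarith [abs_nonneg (μ r : ℝ)]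
      have hsq2 : coprimeLogSum (r * q) (X / r) ^ 2 ≤ (C₀ * ((r : ℝ) / (r.totient : ℝ) * E)) ^ 2 := by
        rw [← sq_abs]
        exact pow_le_pow_left₀ (abs_nonneg _) hb 2
      calc (r.totient : ℝ) * (μ r : ℝ) ^ 2 / (r : ℝ) ^ 2 * coprimeLogSum (r * q) (X / r) ^ 2
          ≤ (r.totient : ℝ) * 1 / (r : ℝ) ^ 2 * (C₀ * ((r : ℝ) / (r.totient : ℝ) * E)) ^ 2 := by
            gcongr
      _ = C₀ ^ 2 * E ^ 2 * (1 / (r.totient : ℝ)) := by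
            field_simp
    · positivity
  · have hμ : (μ r : ℝ) = 0 := by exact_mod_cast ArithmeticFunction.moebius_eq_zero_of_not_squarefree hsq
    rw [if_neg hsq]
    split_ifs
    · rw [hμ]; simp
    · simp

/-- `μ²(n)/φ(n)` as a real arithmetic function. [folklore] -/
def sqMoebiusDivTotient : ArithmeticFunction ℝ :=
  ⟨fun n => if n ≠ 0 ∧ Squarefree n then 1 / (n.totient : ℝ) else 0, by simp⟩

/-- Unfolding `μ²/φ`. [folklore] -/
theorem sqMoebiusDivTotient_apply (n : ℕ) :
    sqMoebiusDivTotient n = if n ≠ 0 ∧ Squarefree n then 1 / (n.totient : ℝ) else 0 := rfl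

/-- `μ²/φ` is multiplicative. [folklore] -/
theorem isMultiplicative_sqMoebiusDivTotient : sqMoebiusDivTotient.IsMultiplicative := by
  refine IsMultiplicative.iff_ne_zero.2 ⟨?_, ?_⟩
  · rw [sqMoebiusDivTotient_apply, if_pos ⟨one_ne_zero, squarefree_one⟩]; simp
  · intro m n hm hn hmn
    have hmn0 : m * n ≠ 0 := Nat.mul_ne_zero hm hn
    simp only [sqMoebiusDivTotient_apply, ne_eq, hmn0, not_false_eq_true, true_and, hm, hn,
      Nat.squarefree_mul_iff, Nat.totient_mul hmn, Nat.cast_mul]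
    by_cases h1 : Squarefree m <;> by_cases h2 : Squarefree n <;> simp [h1, h2, hmn, mul_comm]

/-- **`∑_{r ≤ N} μ²(r)/φ(r) ≤ ∏_{p ≤ N} (1 - 1/p)⁻¹`** (every square-free `r ≤ N` is a product of
distinct primes `≤ N`, and `1/φ(r) = ∏_{p ∣ r} 1/(p-1)`; `1 + 1/(p-1) = (1 - 1/p)⁻¹`). [folklore] -/
theorem sum_sq_moebius_div_totient_le (N : ℕ) :
    ∑ r ∈ (Finset.Icc 1 N).filter Squarefree, 1 / (r.totient : ℝ) ≤
      eulerFactorProd 1 (Nat.primesBelow (N + 1)) := by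
  classical
  have h0 : ∀ n, 0 ≤ sqMoebiusDivTotient n := fun n => by
    rw [sqMoebiusDivTotient_apply]; split_ifs <;> positivity
  have h := SquarefreeSums.sum_le_prod_sum_prime_pow isMultiplicative_sqMoebiusDivTotient h0 N
  have hlhs : ∑ r ∈ (Finset.Icc 1 N).filter Squarefree, 1 / (r.totient : ℝ) =
      ∑ d ∈ Finset.Icc 1 N, sqMoebiusDivTotient d := by
    rw [sum_filter]
    refine sum_congr rfl fun d hd => ?_
    have hd0 : d ≠ 0 := by have := (Finset.mem_Icc.1 hd).1; omega
    rw [sqMoebiusDivTotient_apply]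
    simp [hd0]
  rw [hlhs]
  refine h.trans ?_
  unfold eulerFactorProd
  refine prod_le_prod (fun p _ => sum_nonneg fun j _ => h0 _) fun p hp => ?_
  have hpr := (Nat.mem_primesBelow.1 hp).2
  have hp1 : (1 : ℝ) < p := by exact_mod_cast hpr.one_lt
  -- `∑_{j ≤ N} f(p^j) = f(1) + f(p) = 1 + 1/(p-1) = (1 - 1/p)⁻¹` (`N ≥ 1` as `p < N + 1`)
  have hN1 : 1 ≤ N := by have := (Nat.mem_primesBelow.1 hp).1; have := hpr.two_le; omega
  have hval : ∀ j, sqMoebiusDivTotient (p ^ j) = if j = 0 then 1 else if j = 1 then 1 / ((p : ℝ) - 1) else 0 := by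
    intro j
    rw [sqMoebiusDivTotient_apply]
    rcases Nat.eq_zero_or_pos j with rfl | hj
    · simp
    · rw [if_neg hj.ne']
      by_cases hj1 : j = 1
      · subst hj1
        rw [if_pos rfl, pow_one, if_pos ⟨hpr.ne_zero, hpr.prime.squarefree⟩, Nat.totient_prime hpr]
        rw [Nat.cast_sub hpr.one_le]; simp
      · rw [if_neg hj1, if_neg]
        rintro ⟨-, hsq⟩
        rw [Nat.squarefree_pow_iff hpr.ne_one hj.ne'] at hsq
        exact hj1 hsq.2
  have hsum : ∑ j ∈ Finset.range (N + 1), sqMoebiusDivTotient (p ^ j) = 1 + 1 / ((p : ℝ) - 1) := by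
    rw [Finset.sum_eq_add_of_mem 0 1 (by simp) (by simp; omega) (by norm_num) ?_]
    · rw [hval 0, hval 1]; simp
    · intro c _ hc; rw [hval c]; simp [hc.1, hc.2]
  rw [hsum, Real.rpow_neg_one]
  have hp0 : (p : ℝ) - 1 ≠ 0 := by linarith
  have hp0' : (p : ℝ) ≠ 0 := by linarith
  apply le_of_eq
  field_simp
  ring

/-- **`∏_{p ≤ N} (1 - 1/p)⁻¹ ≤ e⁵ log N`** for `N ≥ 2` (the tree's Mertens-type product bound
`∏_{p ≤ N}(1 - 1/p) ≥ e^{-5}/log N`). [folklore] -/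
theorem eulerFactorProd_primesBelow_le_log {N : ℕ} (hN : 2 ≤ N) :
    eulerFactorProd 1 (Nat.primesBelow (N + 1)) ≤ Real.exp 5 * Real.log N := by
  have h := Literature.NumberTheory.LFunctions.MertensBound.exp_neg_div_log_le_prod_one_sub_inv N hN
  have hN' : (2 : ℝ) ≤ N := by exact_mod_cast hN
  have hlog : 0 < Real.log N := Real.log_pos (by linarith)
  have hprod_pos : 0 < ∏ p ∈ Nat.primesLE N, (1 - 1 / (p : ℝ)) := by
    refine prod_pos fun p hp => ?_
    have hp2 : (2 : ℝ) ≤ p := by exact_mod_cast (Nat.mem_primesLE.1 hp).2.two_le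
    have : 1 / (p : ℝ) ≤ 1 / 2 := by rw [div_le_div_iff₀ (by linarith) (by norm_num)]; linarith
    linarith
  have heq : eulerFactorProd 1 (Nat.primesBelow (N + 1)) = (∏ p ∈ Nat.primesLE N, (1 - 1 / (p : ℝ)))⁻¹ := by
    rw [eulerFactorProd, ← prod_inv_distrib]
    refine prod_congr rfl fun p _ => ?_
    rw [Real.rpow_neg_one, one_div]
  rw [heq, inv_le_comm₀ hprod_pos (by positivity)]
  calc (Real.exp 5 * Real.log N)⁻¹ = Real.exp (-5) / Real.log N := by
        rw [Real.exp_neg]; field_simp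
    _ ≤ _ := h

/-- **The crude bound in closed form**: given `|M₁(u)| ≤ C₀`, for `q ≠ 0` and `X ≥ 2`,
`S_q(X) ≤ C₀² (q/φ(q))² e⁵ log X`. [folklore] -/
theorem selbergS_le_log {C₀ : ℝ} (hC₀ : ∀ u, |moebiusLogSum u| ≤ C₀) {q : ℕ} (hq : q ≠ 0) {X : ℝ}
    (hX : 2 ≤ X) :
    selbergS q X ≤ C₀ ^ 2 * eulerFactorProd 1 q.primeFactors ^ 2 * (Real.exp 5 * Real.log X) := by
  have hX2 : 2 ≤ ⌊X⌋₊ := Nat.le_floor (by exact_mod_cast hX)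
  have hfl : (2 : ℝ) ≤ ⌊X⌋₊ := by exact_mod_cast hX2
  refine (selbergS_le_of_bound hC₀ hq X).trans (mul_le_mul_of_nonneg_left ?_ (by positivity))
  refine (sum_sq_moebius_div_totient_le ⌊X⌋₊).trans ((eulerFactorProd_primesBelow_le_log hX2).trans ?_)
  refine mul_le_mul_of_nonneg_left (Real.log_le_log (by linarith) (Nat.floor_le (by linarith))) (by positivity)

end Literature.NumberTheory.Sieve.GreenTao2008
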